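import Literature.NumberTheory.Automorphic.InfUnitaryLocalExponential
import HarnessLib

/-!
# The exponential series of a skew operator on analytic vectors, II: the unitary operators `expOp`, local group law, time power series, covariance

Topic `NumberTheory/Automorphic`; namespace `Literature.NumberTheory.Automorphic.IsPosDefHerm` (dot notation on `hB : IsPosDefHerm B`); sequel of ★
`InfUnitaryLocalExponential` (`expVec`, weak identity, isometry).  Cell `hodgecm-mathlib`, F0∕P3, ROAD-GLOB to the letter A6 #92
`HasUnitaryGlobalizationOfInfUnitary` [KnappVogan1995, Thm. 0.6 (a)] at `U(2,1)`, brick **P1** (second file).  Definitions WITH BODIES (`expLin`, `expOp`,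
`expSeries`) + theorems; no named fact, no instance, no notation, no `sorry`.  Hypothesis currency (LEAD v1.1 (a)): the UNIFORM factorial bound
`hZb : ∀ v, ∃ C, ∀ n, ‖emb (Zⁿ v)‖ ≤ C · n! · Kⁿ` for a `B`-skew `Z`.

THE MATHEMATICS ([HarishChandra1953, §9]; [Nelson1959, §2]).  (§4) `v ↦ expVec Z a v` is linear (`expLin Z K a`), isometric, hence extends along the
dense `emb` to a bounded operator **`expOp Z K a : E →L[ℂ] E`** with `expOp Z K a (emb v) = expVec Z a v` (`2|a|K < 1`; Mathlib `LinearMap.extendOfNorm`),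
an isometry of `E`.  (§5) **Strong composition** `expOp Z K a (expVec Z b v) = expVec Z (a+b) v` (`4(|a|+|b|)K < 1`; push the bounded operator through
the series and regroup by ★ Cauchy–binomial), hence the **local group law** `expOp Z K a ∘ expOp Z K b = expOp Z K (a+b)`, `expOp Z K 0 = 1`, **unitarity**
(`8|a|K < 1`: isometry + right inverse `expOp Z K (−a)`), and powers `(expOp Z K a)^k = expOp Z K (k a)` (`4k|a|K < 1`).  (§6) In the time variable,
`a ↦ expVec Z a v` is the sum of the power series `expSeries Z v` (`mkPiRing` coefficients `(n!)⁻¹ • emb (Zⁿ v)`) on the ball of radius `K⁻¹`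
(`hasFPowerSeriesOnBall_expVec`): analytic, continuous, with derivative `emb (Z v)` at `0`.  (§7) **Covariance**: a `B`-bounded `u` with `u ∘ Z = Z′ ∘ u`
satisfies `extend u (expVec Z a v) = expVec Z′ a (u v)` and `extend u ∘ expOp Z K a = expOp Z′ K a ∘ extend u` — the shape of `Ad`-compatibility
`ϖK k ∘ exp(s ρ X) = exp(s ρ(Ad k X)) ∘ ϖK k` of the `(𝔤, K)`-module axioms.

HONEST LABEL: brick P1 of the road; closes no registered stub.  HC_CM is proved only modulo the 2 remaining named inputs (hLiu418, h413) until rung 0 closes.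

## Mathlib ∕ tree search
Mathlib: `LinearMap.extendOfNorm`∕`extendOfNorm_eq`, `DenseRange.induction_on`, `Unitary.mem_iff`, `ContinuousLinearMap.norm_map_iff_adjoint_comp_self`,
`ContinuousMultilinearMap.mkPiRing`, `FormalMultilinearSeries.le_radius_of_bound`, `HasFPowerSeriesOnBall`, `HasFPowerSeriesAt.hasDerivAt`, `lt_mul_inv_iff₀`.
Tree: ★ `InfUnitaryHilbertCompletion` (`extend`, `eq_of_forall_emb`), ★ `InfUnitaryLocalExponential`, ★ `CauchyBinomialRegrouping`.  Dedup: `rg "expOp|expLin|expSeries Z"`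
over `Literature/` — no hits.

## References
* Harish-Chandra, *Representations of a semisimple Lie group on a Banach space. I*, Trans. AMS 75 (1953), §9 [HarishChandra1953].
* E. Nelson, *Analytic vectors*, Ann. of Math. 70 (1959), §2 [Nelson1959].
* A. Borel, N. Wallach, *Continuous Cohomology, Discrete Subgroups, and Representations of Reductive Groups*, 2nd ed. (2000), 0 §2.5 [BorelWallach2000].
-/

set_option autoImplicit false

noncomputable section

open Finset
open scoped Nat InnerProductSpace ComplexConjugate
namespace Literature.NumberTheory.Automorphic

namespace IsPosDefHerm

universe u

/-- A norm-preserving operator with a right inverse is unitary. [cite: BorelWallach2000, 0 §2.5] -/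
theorem mem_unitary_of_norm_map_of_rightInverse {H : Type*} [NormedAddCommGroup H] [InnerProductSpace ℂ H] [CompleteSpace H]
    (U U' : H →L[ℂ] H) (hU : ∀ z, ‖U z‖ = ‖z‖) (h : U ∘L U' = 1) : U ∈ unitary (H →L[ℂ] H) := by
  have h1 : star U * U = 1 := by
    rw [ContinuousLinearMap.star_eq_adjoint]
    exact (ContinuousLinearMap.norm_map_iff_adjoint_comp_self _).mp hU
  have hsurj : Function.Surjective U := fun z =>
    ⟨U' z, by simpa using congrArg (fun A : H →L[ℂ] H => A z) h⟩
  refine Unitary.mem_iff.mpr ⟨h1, ContinuousLinearMap.ext fun z => ?_⟩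
  obtain ⟨w, rfl⟩ := hsurj z
  have := congrArg (fun A : H →L[ℂ] H => U (A w)) h1
  simpa [mul_assoc] using this

variable {V : Type u} [AddCommGroup V] [Module ℂ V] {B : V →ₗ⋆[ℂ] V →ₗ[ℂ] ℂ} (hB : IsPosDefHerm B)
include hB

variable (Z : V →ₗ[ℂ] V)

/-! ## §4 Linearity in the vector and the bounded operator `expOp` -/

/-- `expVec` is additive in `v` (both series summable). [cite: Nelson1959, §2] -/
theorem expVec_add {K Cv Cw : ℝ} (hK : 0 ≤ K) {v w : V} (hv : ∀ n, ‖hB.emb ((Z ^ n) v)‖ ≤ Cv * n ! * K ^ n)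
    (hw : ∀ n, ‖hB.emb ((Z ^ n) w)‖ ≤ Cw * n ! * K ^ n) {a : ℝ} (ha : |a| * K < 1) :
    hB.expVec Z a (v + w) = hB.expVec Z a v + hB.expVec Z a w := by
  have h := (hB.hasSum_expVec Z hK hv ha).add (hB.hasSum_expVec Z hK hw ha)
  rw [← h.tsum_eq]
  unfold expVec
  exact tsum_congr fun n => by rw [map_add, map_add, smul_add]

/-- `expVec` is homogeneous in `v`. [cite: Nelson1959, §2] -/
theorem expVec_smul {K C : ℝ} (hK : 0 ≤ K) {v : V} (hv : ∀ n, ‖hB.emb ((Z ^ n) v)‖ ≤ C * n ! * K ^ n) {a : ℝ}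
    (ha : |a| * K < 1) (c : ℂ) : hB.expVec Z a (c • v) = c • hB.expVec Z a v := by
  have h := (hB.hasSum_expVec Z hK hv ha).const_smul c
  rw [← h.tsum_eq]
  unfold expVec
  exact tsum_congr fun n => by rw [map_smul, map_smul, smul_comm]

/-- The uniform factorial bound (every vector has `‖emb (Zⁿ v)‖ ≤ C_v · n! · Kⁿ` with the SAME `K`, the analytic-vector hypothesis of
[Nelson1959, §2]) is stable under scalars: a bound for `c • v`. [cite: Nelson1959, §2] -/
theorem bound_smul {K : ℝ} (hZb : ∀ v : V, ∃ C : ℝ, ∀ n, ‖hB.emb ((Z ^ n) v)‖ ≤ C * n ! * K ^ n) (c : ℂ) (v : V) :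
    ∃ C : ℝ, ∀ n, ‖hB.emb ((Z ^ n) (c • v))‖ ≤ C * n ! * K ^ n := by
  obtain ⟨C, hC⟩ := hZb v
  refine ⟨‖c‖ * C, fun n => ?_⟩
  rw [map_smul, map_smul, norm_smul, mul_assoc, mul_assoc]
  exact mul_le_mul_of_nonneg_left (by simpa [mul_assoc] using hC n) (norm_nonneg c)

/-- **`expLin Z a : V →ₗ[ℂ] E`**, the exponential series as a LINEAR map in the vector (junk `0` unless every vector has a factorial bound with
constant `K` and `|a| K < 1`). [cite: HarishChandra1953, §9] -/
def expLin (K : ℝ) (a : ℝ) : V →ₗ[ℂ] hB.E :=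
  open scoped Classical in
  if h : 0 ≤ K ∧ |a| * K < 1 ∧ ∀ v : V, ∃ C : ℝ, ∀ n, ‖hB.emb ((Z ^ n) v)‖ ≤ C * n ! * K ^ n then
    { toFun := fun v => hB.expVec Z a v
      map_add' := fun v w => by
        obtain ⟨Cv, hv⟩ := h.2.2 v
        obtain ⟨Cw, hw⟩ := h.2.2 w
        exact hB.expVec_add Z h.1 hv hw h.2.1
      map_smul' := fun c v => by
        obtain ⟨Cv, hv⟩ := h.2.2 v
        exact hB.expVec_smul Z h.1 hv h.2.1 c }
  else 0

/-- `expLin Z K a v = expVec Z a v` under the hypotheses. [cite: HarishChandra1953, §9] -/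
theorem expLin_apply {K : ℝ} (hK : 0 ≤ K) (hZb : ∀ v : V, ∃ C : ℝ, ∀ n, ‖hB.emb ((Z ^ n) v)‖ ≤ C * n ! * K ^ n) {a : ℝ}
    (ha : |a| * K < 1) (v : V) : hB.expLin Z K a v = hB.expVec Z a v := by
  unfold expLin
  classical
  rw [dif_pos ⟨hK, ha, hZb⟩]
  rfl

/-- **`expOp Z K a : E →L[ℂ] E`** — the bounded extension of `expLin Z K a` along `emb` (Mathlib `LinearMap.extendOfNorm`).
[cite: HarishChandra1953, §9] -/
def expOp (K : ℝ) (a : ℝ) : hB.E →L[ℂ] hB.E :=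
  (hB.expLin Z K a).extendOfNorm hB.emb

/-- **`expOp Z K a (emb v) = expVec Z a v`** for `B`-skew `Z` with uniform factorial bounds and `2|a|K < 1`. [cite: HarishChandra1953, §9] -/
theorem expOp_emb (hZ : ∀ x y, B (Z x) y = -B x (Z y)) {K : ℝ} (hK : 0 ≤ K)
    (hZb : ∀ v : V, ∃ C : ℝ, ∀ n, ‖hB.emb ((Z ^ n) v)‖ ≤ C * n ! * K ^ n) {a : ℝ} (ha : 2 * |a| * K < 1) (v : V) :
    hB.expOp Z K a (hB.emb v) = hB.expVec Z a v := by
  have ha' : |a| * K < 1 := by nlinarith [abs_nonneg a]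
  have h := LinearMap.extendOfNorm_eq (f := hB.expLin Z K a) (e := hB.emb) hB.denseRange_emb
    ⟨1, fun x => by
      obtain ⟨C, hC⟩ := hZb x
      rw [hB.expLin_apply Z hK hZb ha', hB.norm_expVec Z hZ hK hC ha, one_mul]⟩ v
  rw [expOp, h, hB.expLin_apply Z hK hZb ha']

/-- `‖expOp Z K a z‖ = ‖z‖` (isometry of `E`, by density). [cite: HarishChandra1953, §9] -/
theorem norm_expOp (hZ : ∀ x y, B (Z x) y = -B x (Z y)) {K : ℝ} (hK : 0 ≤ K)
    (hZb : ∀ v : V, ∃ C : ℝ, ∀ n, ‖hB.emb ((Z ^ n) v)‖ ≤ C * n ! * K ^ n) {a : ℝ} (ha : 2 * |a| * K < 1) (z : hB.E) :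
    ‖hB.expOp Z K a z‖ = ‖z‖ := by
  refine hB.denseRange_emb.induction_on (p := fun z => ‖hB.expOp Z K a z‖ = ‖z‖) z ?_ ?_
  · exact isClosed_eq ((hB.expOp Z K a).continuous.norm) continuous_norm
  · intro x
    obtain ⟨C, hC⟩ := hZb x
    rw [hB.expOp_emb Z hZ hK hZb ha, hB.norm_expVec Z hZ hK hC ha]

/-! ## §5 The strong composition identity and the local group law -/

/-- **STRONG COMPOSITION** `expOp Z K a (expVec Z b v) = expVec Z (a+b) v` for `4(|a|+|b|)K < 1`: apply the bounded `expOp` termwise to the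
series of `expVec Z b v`, expand each `expVec Z a (Zⁿ v)`, and regroup by Cauchy–binomial. [cite: HarishChandra1953, §9] [cite: Nelson1959, §2] -/
theorem expOp_expVec (hZ : ∀ x y, B (Z x) y = -B x (Z y)) {K : ℝ} (hK : 0 ≤ K)
    (hZb : ∀ v : V, ∃ C : ℝ, ∀ n, ‖hB.emb ((Z ^ n) v)‖ ≤ C * n ! * K ^ n) {a b : ℝ} (hab : 4 * (|a| + |b|) * K < 1) (v : V) :
    hB.expOp Z K a (hB.expVec Z b v) = hB.expVec Z (a + b) v := by
  obtain ⟨C, hC⟩ := hZb v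
  have hb : |b| * K < 1 := by nlinarith [abs_nonneg a, abs_nonneg b]
  have ha2 : 2 * |a| * K < 1 := by nlinarith [abs_nonneg a, abs_nonneg b]
  have ha1 : |a| * K < 1 := by nlinarith [abs_nonneg a, abs_nonneg b]
  -- Step 1: push `expOp` through the series of `expVec Z b v`
  have h1 : HasSum (fun n : ℕ => hB.expOp Z K a ((b ^ n / (n ! : ℝ)) • hB.emb ((Z ^ n) v))) (hB.expOp Z K a (hB.expVec Z b v)) :=
    (hB.hasSum_expVec Z hK hC hb).mapL (hB.expOp Z K a)
  -- Step 2: each term is `(bⁿ∕n!) • expVec Z a (Zⁿ v) = Σ_m (aᵐ bⁿ∕(m! n!)) • emb (Z^{m+n} v)`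
  set F : ℕ → hB.E := fun N => hB.emb ((Z ^ N) v) with hF
  have h2 : ∀ n : ℕ, hB.expOp Z K a ((b ^ n / (n ! : ℝ)) • hB.emb ((Z ^ n) v)) =
      ∑' m : ℕ, (a ^ m * b ^ n / ((m ! : ℝ) * (n ! : ℝ))) • F (m + n) := by
    intro n
    obtain ⟨Cn, hCn⟩ := hZb ((Z ^ n) v)
    rw [ContinuousLinearMap.map_smul_of_tower, hB.expOp_emb Z hZ hK hZb ha2]
    have h3 := (hB.hasSum_expVec Z hK hCn ha1).const_smul (b ^ n / (n ! : ℝ))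
    rw [← h3.tsum_eq]
    refine tsum_congr fun m => ?_
    rw [smul_smul, hF]
    dsimp only
    rw [← Module.End.mul_apply, ← pow_add]
    congr 1
    field_simp
  -- Step 3: Cauchy–binomial in `E`
  have hFs : Summable fun N => (|a| + |b|) ^ N / (N ! : ℝ) * ‖F N‖ := by
    refine Summable.of_nonneg_of_le (fun N => by positivity) (fun N => ?_)
      ((summable_geometric_of_lt_one (by positivity) (by nlinarith [abs_nonneg a, abs_nonneg b] : (|a| + |b|) * K < 1)).mul_left C)
    have hN : (0 : ℝ) < N ! := by positivity
    calc (|a| + |b|) ^ N / (N ! : ℝ) * ‖F N‖ ≤ (|a| + |b|) ^ N / (N ! : ℝ) * (C * N ! * K ^ N) := by gcongr; exact hC N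
      _ = C * ((|a| + |b|) * K) ^ N := by rw [mul_pow]; field_simp
  have hcb := CauchyBinomial.hasSum_iterated a b F hFs
  have h4 : HasSum (fun n : ℕ => ∑' m : ℕ, (a ^ m * b ^ n / ((m ! : ℝ) * (n ! : ℝ))) • F (m + n))
      (hB.expOp Z K a (hB.expVec Z b v)) := h1.congr_fun fun n => (h2 n).symm
  rw [h4.unique hcb]
  rfl

/-- **LOCAL GROUP LAW** `expOp Z K a ∘ expOp Z K b = expOp Z K (a+b)` for `4(|a|+|b|)K < 1`. [cite: HarishChandra1953, §9] -/
theorem expOp_comp (hZ : ∀ x y, B (Z x) y = -B x (Z y)) {K : ℝ} (hK : 0 ≤ K)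
    (hZb : ∀ v : V, ∃ C : ℝ, ∀ n, ‖hB.emb ((Z ^ n) v)‖ ≤ C * n ! * K ^ n) {a b : ℝ} (hab : 4 * (|a| + |b|) * K < 1) :
    hB.expOp Z K a ∘L hB.expOp Z K b = hB.expOp Z K (a + b) := by
  have hb : 2 * |b| * K < 1 := by nlinarith [abs_nonneg a, abs_nonneg b]
  have hab' : 2 * |a + b| * K < 1 := by nlinarith [abs_nonneg a, abs_nonneg b, abs_add_le a b]
  refine hB.eq_of_forall_emb fun v => ?_
  rw [ContinuousLinearMap.comp_apply, hB.expOp_emb Z hZ hK hZb hb, hB.expOp_expVec Z hZ hK hZb hab, hB.expOp_emb Z hZ hK hZb hab']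

/-- `expOp Z K 0 = 1`. [cite: HarishChandra1953, §9] -/
theorem expOp_zero (hZ : ∀ x y, B (Z x) y = -B x (Z y)) {K : ℝ} (hK : 0 ≤ K)
    (hZb : ∀ v : V, ∃ C : ℝ, ∀ n, ‖hB.emb ((Z ^ n) v)‖ ≤ C * n ! * K ^ n) : hB.expOp Z K 0 = 1 :=
  hB.eq_of_forall_emb fun v => by
    rw [hB.expOp_emb Z hZ hK hZb (by simp), hB.expVec_zero]; rfl

/-- **`expOp Z K a` IS UNITARY** for `8|a|K < 1` (isometry + right inverse `expOp Z K (−a)`). [cite: HarishChandra1953, §9] -/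
theorem expOp_mem_unitary (hZ : ∀ x y, B (Z x) y = -B x (Z y)) {K : ℝ} (hK : 0 ≤ K)
    (hZb : ∀ v : V, ∃ C : ℝ, ∀ n, ‖hB.emb ((Z ^ n) v)‖ ≤ C * n ! * K ^ n) {a : ℝ} (ha : 8 * |a| * K < 1) :
    hB.expOp Z K a ∈ unitary (hB.E →L[ℂ] hB.E) := by
  have ha2 : 2 * |a| * K < 1 := by nlinarith [abs_nonneg a]
  have haa : 4 * (|a| + |(-a)|) * K < 1 := by rw [abs_neg]; nlinarith [abs_nonneg a]
  refine mem_unitary_of_norm_map_of_rightInverse _ (hB.expOp Z K (-a)) (hB.norm_expOp Z hZ hK hZb ha2) ?_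
  rw [hB.expOp_comp Z hZ hK hZb haa, add_neg_cancel, hB.expOp_zero Z hZ hK hZb]

/-- **Powers**: `(expOp Z K a)^k = expOp Z K (k a)` when `4 k |a| K < 1`. [cite: Nelson1959, §2] -/
theorem expOp_pow (hZ : ∀ x y, B (Z x) y = -B x (Z y)) {K : ℝ} (hK : 0 ≤ K)
    (hZb : ∀ v : V, ∃ C : ℝ, ∀ n, ‖hB.emb ((Z ^ n) v)‖ ≤ C * n ! * K ^ n) {a : ℝ} (k : ℕ) (hk : 4 * (k * |a|) * K < 1) :
    hB.expOp Z K a ^ k = hB.expOp Z K (k * a) := by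
  induction k with
  | zero => simp [hB.expOp_zero Z hZ hK hZb]
  | succ k ih =>
    have hk1 : 4 * ((k : ℝ) * |a| + |a|) * K < 1 := by
      have e : 4 * ((k : ℝ) * |a| + |a|) * K = 4 * (((k + 1 : ℕ) : ℝ) * |a|) * K := by push_cast; ring
      rw [e]; exact hk
    have hk' : 4 * ((k : ℝ) * |a|) * K < 1 := by
      refine lt_of_le_of_lt ?_ hk1
      have : 0 ≤ 4 * |a| * K := by positivity
      nlinarith
    rw [pow_succ, ih hk', ContinuousLinearMap.mul_def, hB.expOp_comp Z hZ hK hZb]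
    · congr 1; push_cast; ring
    · rwa [abs_mul, Nat.abs_cast]

/-! ## §6 The power series in the time variable: analyticity and the derivative at `0` -/

/-- The coefficients of `a ↦ expVec Z a v` as a formal multilinear series over `ℝ`: `p n = mkPiRing ((n!)⁻¹ • emb (Zⁿ v))`.
[cite: Nelson1959, §2] -/
def expSeries (v : V) : FormalMultilinearSeries ℝ ℝ hB.E := fun n =>
  ContinuousMultilinearMap.mkPiRing ℝ (Fin n) (((n ! : ℝ)⁻¹) • hB.emb ((Z ^ n) v))

/-- `expSeries v n (fun _ => a) = (aⁿ ∕ n!) • emb (Zⁿ v)`. [cite: Nelson1959, §2] -/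
theorem expSeries_apply (v : V) (n : ℕ) (a : ℝ) :
    hB.expSeries Z v n (fun _ => a) = (a ^ n / (n ! : ℝ)) • hB.emb ((Z ^ n) v) := by
  rw [expSeries, ContinuousMultilinearMap.mkPiRing_apply, smul_smul, Finset.prod_const, Finset.card_univ, Fintype.card_fin,
    div_eq_mul_inv]

/-- The radius of `expSeries v` is at least `K⁻¹` under the factorial bound. [cite: Nelson1959, §2] -/
theorem le_radius_expSeries {K C : ℝ} (hK : 0 < K) {v : V} (hv : ∀ n, ‖hB.emb ((Z ^ n) v)‖ ≤ C * n ! * K ^ n) :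
    ((Real.toNNReal K)⁻¹ : NNReal) ≤ (hB.expSeries Z v).radius := by
  refine FormalMultilinearSeries.le_radius_of_bound _ (max C 0) fun n => ?_
  rw [expSeries, ContinuousMultilinearMap.norm_mkPiRing, norm_smul, norm_inv, Real.norm_eq_abs,
    abs_of_pos (by positivity : (0 : ℝ) < n !), NNReal.coe_inv, Real.coe_toNNReal K hK.le]
  have hn : (0 : ℝ) < n ! := by positivity
  calc (n ! : ℝ)⁻¹ * ‖hB.emb ((Z ^ n) v)‖ * K⁻¹ ^ n ≤ (n ! : ℝ)⁻¹ * (C * n ! * K ^ n) * K⁻¹ ^ n := by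
        gcongr; exact hv n
    _ = C := by rw [inv_pow]; field_simp
    _ ≤ max C 0 := le_max_left _ _

omit hB in
/-- `|y| < K⁻¹ ↔ |y| K < 1` (`K > 0`). [folklore] -/
private theorem abs_lt_inv_iff {K : ℝ} (hK : 0 < K) (y : ℝ) : |y| < K⁻¹ ↔ |y| * K < 1 := by
  rw [← one_mul K⁻¹]; exact lt_mul_inv_iff₀ hK

/-- **`a ↦ expVec Z a v` is given by its power series on the ball of radius `K⁻¹`.** [cite: Nelson1959, §2] -/
theorem hasFPowerSeriesOnBall_expVec {K C : ℝ} (hK : 0 < K) {v : V} (hv : ∀ n, ‖hB.emb ((Z ^ n) v)‖ ≤ C * n ! * K ^ n) :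
    HasFPowerSeriesOnBall (fun a : ℝ => hB.expVec Z a v) (hB.expSeries Z v) 0 ((Real.toNNReal K)⁻¹ : NNReal) := by
  refine ⟨hB.le_radius_expSeries Z hK hv, ENNReal.coe_pos.mpr (inv_pos.mpr (Real.toNNReal_pos.mpr hK)), fun {y} hy => ?_⟩
  rw [zero_add]
  have hy' : |y| * K < 1 := by
    rw [Metric.eball_coe, Metric.mem_ball, dist_zero_right, Real.norm_eq_abs, NNReal.coe_inv,
      Real.coe_toNNReal K hK.le] at hy
    exact (abs_lt_inv_iff hK y).mp hy
  exact (hB.hasSum_expVec Z hK.le hv hy').congr_fun fun n => hB.expSeries_apply Z v n y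

/-- **Analyticity** of `a ↦ expVec Z a v` at every `|a₀| K < 1`. [cite: Nelson1959, §2] -/
theorem analyticAt_expVec {K C : ℝ} (hK : 0 < K) {v : V} (hv : ∀ n, ‖hB.emb ((Z ^ n) v)‖ ≤ C * n ! * K ^ n) {a₀ : ℝ}
    (ha₀ : |a₀| * K < 1) : AnalyticAt ℝ (fun a : ℝ => hB.expVec Z a v) a₀ := by
  refine (hB.hasFPowerSeriesOnBall_expVec Z hK hv).analyticAt_of_mem ?_
  rw [Metric.eball_coe, Metric.mem_ball, dist_zero_right, Real.norm_eq_abs, NNReal.coe_inv, Real.coe_toNNReal K hK.le]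
  exact (abs_lt_inv_iff hK a₀).mpr ha₀

/-- **Continuity** of `a ↦ expVec Z a v` at every `|a₀| K < 1`. [cite: Nelson1959, §2] -/
theorem continuousAt_expVec {K C : ℝ} (hK : 0 < K) {v : V} (hv : ∀ n, ‖hB.emb ((Z ^ n) v)‖ ≤ C * n ! * K ^ n) {a₀ : ℝ}
    (ha₀ : |a₀| * K < 1) : ContinuousAt (fun a : ℝ => hB.expVec Z a v) a₀ :=
  (hB.analyticAt_expVec Z hK hv ha₀).continuousAt

/-- **The derivative at `0`**: `d/da|₀ expVec Z a v = emb (Z v)`. [cite: HarishChandra1953, §9] [cite: Nelson1959, §2] -/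
theorem hasDerivAt_expVec_zero {K C : ℝ} (hK : 0 < K) {v : V} (hv : ∀ n, ‖hB.emb ((Z ^ n) v)‖ ≤ C * n ! * K ^ n) :
    HasDerivAt (fun a : ℝ => hB.expVec Z a v) (hB.emb (Z v)) 0 := by
  have h := (hB.hasFPowerSeriesOnBall_expVec Z hK hv).hasFPowerSeriesAt.hasDerivAt
  have h1 : hB.expSeries Z v 1 (fun _ => 1) = hB.emb (Z v) := by
    rw [hB.expSeries_apply, one_pow, pow_one, Nat.factorial_one, Nat.cast_one, div_one, one_smul]
  rwa [h1] at h

/-! ## §7 Covariance under a `B`-bounded intertwiner -/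

/-- **Covariance**: if `u` is `B`-bounded and `u ∘ Z = Z′ ∘ u`, then `extend u (expVec Z a v) = expVec Z′ a (u v)` (termwise). [cite: HarishChandra1953, §9] -/
theorem extend_expVec {u : V →ₗ[ℂ] V} (hu : ∃ C : ℝ, ∀ x, ‖hB.emb (u x)‖ ≤ C * ‖hB.emb x‖) {Z' : V →ₗ[ℂ] V}
    (hcomm : u ∘ₗ Z = Z' ∘ₗ u) {K C : ℝ} (hK : 0 ≤ K) {v : V} (hv : ∀ n, ‖hB.emb ((Z ^ n) v)‖ ≤ C * n ! * K ^ n) {a : ℝ}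
    (ha : |a| * K < 1) : hB.extend u (hB.expVec Z a v) = hB.expVec Z' a (u v) := by
  have hpow : ∀ n : ℕ, u ((Z ^ n) v) = (Z' ^ n) (u v) := by
    intro n
    induction n with
    | zero => simp
    | succ n ih =>
      rw [pow_succ', pow_succ', Module.End.mul_apply, Module.End.mul_apply, ← ih]
      exact LinearMap.congr_fun hcomm ((Z ^ n) v)
  obtain ⟨Cu, hCu⟩ := hB.exists_bound_nonneg hu
  have hv' : ∀ n, ‖hB.emb ((Z' ^ n) (u v))‖ ≤ (Cu * C) * n ! * K ^ n := fun n => by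
    rw [← hpow n]
    refine (hCu.2 _).trans ?_
    rw [mul_assoc, mul_assoc]
    exact mul_le_mul_of_nonneg_left (by simpa [mul_assoc] using hv n) hCu.1
  have h1 := (hB.hasSum_expVec Z hK hv ha).mapL (hB.extend u)
  have h2 := hB.hasSum_expVec Z' hK hv' ha
  refine h1.unique (h2.congr_fun fun n => ?_)
  simp only [ContinuousLinearMap.map_smul_of_tower, hB.extend_emb hu, hpow n]

/-- **Operator covariance**: `extend u ∘ expOp Z K a = expOp Z′ K a ∘ extend u` when both `Z, Z′` are `B`-skew with uniform factorial
bounds, `u` is `B`-bounded, `u ∘ Z = Z′ ∘ u`, and `2|a|K < 1`. [cite: HarishChandra1953, §9] -/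
theorem extend_comp_expOp {u : V →ₗ[ℂ] V} (hu : ∃ C : ℝ, ∀ x, ‖hB.emb (u x)‖ ≤ C * ‖hB.emb x‖) {Z' : V →ₗ[ℂ] V}
    (hcomm : u ∘ₗ Z = Z' ∘ₗ u) (hZ : ∀ x y, B (Z x) y = -B x (Z y)) (hZ' : ∀ x y, B (Z' x) y = -B x (Z' y)) {K : ℝ} (hK : 0 ≤ K)
    (hZb : ∀ v : V, ∃ C : ℝ, ∀ n, ‖hB.emb ((Z ^ n) v)‖ ≤ C * n ! * K ^ n)
    (hZb' : ∀ v : V, ∃ C : ℝ, ∀ n, ‖hB.emb ((Z' ^ n) v)‖ ≤ C * n ! * K ^ n) {a : ℝ} (ha : 2 * |a| * K < 1) :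
    hB.extend u ∘L hB.expOp Z K a = hB.expOp Z' K a ∘L hB.extend u := by
  have ha' : |a| * K < 1 := by nlinarith [abs_nonneg a]
  refine hB.eq_of_forall_emb fun v => ?_
  obtain ⟨C, hC⟩ := hZb v
  rw [ContinuousLinearMap.comp_apply, ContinuousLinearMap.comp_apply, hB.expOp_emb Z hZ hK hZb ha,
    hB.extend_expVec Z hu hcomm hK hC ha', hB.extend_emb hu, hB.expOp_emb Z' hZ' hK hZb' ha]

end IsPosDefHerm

end Literature.NumberTheory.Automorphic

end
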